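import Summits.Ventures.HodgeKum4.Theorems.KummerFixedLocusL1HilbDefs
import Literature.AlgebraicGeometry.Hyperkaehler.TotalCohomologyCross
import Literature.AlgebraicTopology.SingularHomology.CupProductExteriorH1
import HarnessLib

/-!
# Lane (V), line v2p5 — stub S-C (auxiliaries): ordered cup products of four degree-one classes and their
# structure constants `b_I ⌣ b_J = wsign(I,J) · b_{I ∪ J}`

Cell `hodge-kum4`, crux stmt-Ventures-20141, registered stub `stub_model` (sequel).  For a topological space `Y` and
four classes `f₀, …, f₃ ∈ H¹(Y; ℂ)` put `e_i = f_i ∈ H*(Y; ℂ)` and, for a bitmask `I ⊂ {0,1,2,3}`,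
`bvec f I = e_{i₁} ⌣ (e_{i₂} ⌣ ⋯)` over the set bits in increasing order.  Graded commutativity in degree one
(`e_j e_i = −e_i e_j`, `e_i e_i = 0`) and associativity of the tree's `totalCup` give, by insertion sort,
`bvec f I ⌣ bvec f J = wsign I J • bvec f (bor I J)` (`wsign`, `bor` of `…L1HilbDefs`: the sign `(−1)^{#inversions}`,
`0` if `I ∩ J ≠ ∅`); the combinatorial glue between the recursive list bookkeeping and the bit arithmetic of
`wsign`/`inversions`/`bor`/`deg4` is checked by `decide` over the `256` pairs.  Also: `bvec f I ∈ H^{|I|}`, `bvec f 0 = 1`.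
Nothing here asserts L1-Hilb(n) / L1 / HC_Kum4Type / HC.
-/

noncomputable section

open DirectSum
open Literature.AlgebraicTopology.SingularHomology
open Literature.AlgebraicGeometry.Hyperkaehler

namespace Summit.Ventures.HodgeKum4.L1Hilb

namespace Model

variable {Y : Type} [TopologicalSpace Y]

/-! ### Degree-one classes in `H*(Y; ℂ)`: squares vanish, distinct ones anticommute -/

/-- The class `f_i ∈ H¹` placed in the total cohomology. -/
def e (f : Fin 4 → singularCohomology ℂ ℂ Y 1) (i : Fin 4) : totalCohomology ℂ Y :=
  ofDegree ℂ Y 1 (f i)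

variable (f : Fin 4 → singularCohomology ℂ ℂ Y 1)

/-- `e_i` is homogeneous of degree `1`. -/
theorem e_def (i : Fin 4) : e f i = ofDegree ℂ Y 1 (f i) := rfl

/-- `e_i ⌣ e_j = −e_j ⌣ e_i` (graded commutativity in degree one). -/
theorem e_mul_comm (i j : Fin 4) :
    totalCup ℂ Y (e f i) (e f j) = -totalCup ℂ Y (e f j) (e f i) := by
  rw [e_def, e_def, totalCup_lof, totalCup_lof, cupProduct_gradedComm_holds ℂ Y rfl rfl (f i) (f j)]
  simp

/-- `e_i ⌣ e_i = 0`. -/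
theorem e_mul_self (i : Fin 4) : totalCup ℂ Y (e f i) (e f i) = 0 := by
  rw [e_def, totalCup_lof, cup_self_deg_one, map_zero]

/-- `e_j ⌣ (e_i ⌣ x) = −e_i ⌣ (e_j ⌣ x)`. -/
theorem e_mul_e_mul (i j : Fin 4) (x : totalCohomology ℂ Y) :
    totalCup ℂ Y (e f j) (totalCup ℂ Y (e f i) x) = -totalCup ℂ Y (e f i) (totalCup ℂ Y (e f j) x) := by
  rw [← totalCup_assoc, e_mul_comm f j i, map_neg, LinearMap.neg_apply, totalCup_assoc]

/-- `e_i ⌣ (e_i ⌣ x) = 0`. -/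
theorem e_mul_e_mul_self (i : Fin 4) (x : totalCohomology ℂ Y) :
    totalCup ℂ Y (e f i) (totalCup ℂ Y (e f i) x) = 0 := by
  rw [← totalCup_assoc, e_mul_self, map_zero, LinearMap.zero_apply]

/-! ### Ordered products over lists of indices -/

/-- `prodList f [i₁, …, i_k] = e_{i₁} ⌣ (e_{i₂} ⌣ (⋯ ⌣ (e_{i_k} ⌣ 1)))`. -/
def prodList (l : List (Fin 4)) : totalCohomology ℂ Y :=
  l.foldr (fun i x ↦ totalCup ℂ Y (e f i) x) (ofDegree ℂ Y 0 (singularCohomology.one ℂ Y))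

/-- Unfolding on `[]`. -/
theorem prodList_nil : prodList f [] = ofDegree ℂ Y 0 (singularCohomology.one ℂ Y) := rfl

/-- Unfolding on a cons. -/
theorem prodList_cons (i : Fin 4) (l : List (Fin 4)) :
    prodList f (i :: l) = totalCup ℂ Y (e f i) (prodList f l) := rfl

/-- The number of transpositions used to insert `i` into `l` in front of the first element `> i`
(mirrors `List.orderedInsert (· < ·)`). -/
def insCount (i : Fin 4) : List (Fin 4) → ℕ
  | [] => 0
  | j :: l => if i < j then 0 else insCount i l + 1

/-- Insertion of `i` into `l` before the first larger element. -/
def ins (i : Fin 4) : List (Fin 4) → List (Fin 4)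
  | [] => [i]
  | j :: l => if i < j then i :: j :: l else j :: ins i l

/-- Iterated insertion of `l₁` into `l₂` (right fold) and the accumulated transposition count. -/
def mergeIns : List (Fin 4) → List (Fin 4) → List (Fin 4)
  | [], l₂ => l₂
  | i :: l₁, l₂ => ins i (mergeIns l₁ l₂)

/-- The accumulated number of transpositions of `mergeIns`. -/
def invCount : List (Fin 4) → List (Fin 4) → ℕ
  | [], _ => 0
  | i :: l₁, l₂ => insCount i (mergeIns l₁ l₂) + invCount l₁ l₂

/-- Boolean disjointness of two index lists. -/
def disj (l₁ l₂ : List (Fin 4)) : Bool :=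
  l₁.all fun i ↦ !(l₂.elem i)

/-- `disj` means: no element of `l₁` lies in `l₂`. -/
theorem disj_iff {l₁ l₂ : List (Fin 4)} : disj l₁ l₂ = true ↔ ∀ i ∈ l₁, i ∉ l₂ := by
  simp [disj]

/-- A repeated index kills the product: `i ∈ l ⇒ e_i ⌣ prodList l = 0`. -/
theorem e_mul_prodList_of_mem {i : Fin 4} {l : List (Fin 4)} (h : i ∈ l) :
    totalCup ℂ Y (e f i) (prodList f l) = 0 := by
  induction l with
  | nil => simp at h
  | cons j l ih =>
    rw [prodList_cons]
    rcases List.mem_cons.mp h with rfl | h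
    · exact e_mul_e_mul_self f i _
    · rw [e_mul_e_mul, ih h, map_zero, neg_zero]

/-- **Insertion**: for `i ∉ l`, `e_i ⌣ prodList l = (−1)^{insCount i l} • prodList (ins i l)`. -/
theorem e_mul_prodList {i : Fin 4} {l : List (Fin 4)} (h : i ∉ l) :
    totalCup ℂ Y (e f i) (prodList f l) = ((-1 : ℂ) ^ insCount i l) • prodList f (ins i l) := by
  induction l with
  | nil => simp [insCount, ins, prodList_cons]
  | cons j l ih =>
    have hij : i ≠ j := fun hh ↦ h (hh ▸ List.mem_cons_self)
    have hil : i ∉ l := fun hh ↦ h (List.mem_cons_of_mem _ hh)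
    by_cases hlt : i < j
    · simp [insCount, ins, hlt, prodList_cons]
    · rw [insCount, ins, if_neg hlt, if_neg hlt, prodList_cons, prodList_cons, e_mul_e_mul, ih hil, map_smul,
        pow_succ, mul_neg_one, neg_smul]

/-- Membership in `ins`. -/
theorem mem_ins {k i : Fin 4} {l : List (Fin 4)} : k ∈ ins i l ↔ k = i ∨ k ∈ l := by
  induction l with
  | nil => simp [ins]
  | cons j l ih =>
    by_cases hlt : i < j
    · simp [ins, hlt]
    · simp [ins, hlt, ih]; tauto

/-- Membership in `mergeIns`. -/
theorem mem_mergeIns {k : Fin 4} {l₁ l₂ : List (Fin 4)} : k ∈ mergeIns l₁ l₂ ↔ k ∈ l₁ ∨ k ∈ l₂ := by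
  induction l₁ with
  | nil => simp [mergeIns]
  | cons i l₁ ih => simp [mergeIns, mem_ins, ih]; tauto

/-- **Product of two ordered products**: `0` if an index repeats, else `(−1)^{invCount} • prodList (mergeIns l₁ l₂)`
(for `l₁` without duplicates). -/
theorem prodList_mul (l₁ l₂ : List (Fin 4)) (h₁ : l₁.Nodup) :
    totalCup ℂ Y (prodList f l₁) (prodList f l₂) =
      if disj l₁ l₂ = true then ((-1 : ℂ) ^ invCount l₁ l₂) • prodList f (mergeIns l₁ l₂) else 0 := by
  induction l₁ with
  | nil => simp [prodList_nil, one_totalCup, invCount, mergeIns, disj]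
  | cons i l₁ ih =>
    rw [List.nodup_cons] at h₁
    rw [prodList_cons, totalCup_assoc, ih h₁.2]
    by_cases hd : disj (i :: l₁) l₂ = true
    · have hd0 := disj_iff.mp hd
      have hd' : disj l₁ l₂ = true := disj_iff.mpr fun k hk ↦ hd0 k (List.mem_cons_of_mem _ hk)
      have hi2 : i ∉ l₂ := hd0 i List.mem_cons_self
      have him : i ∉ mergeIns l₁ l₂ := fun hh ↦ by
        rcases mem_mergeIns.mp hh with hh | hh
        · exact h₁.1 hh
        · exact hi2 hh
      rw [if_pos hd, if_pos hd', map_smul, e_mul_prodList f him, smul_smul, invCount, mergeIns, pow_add, mul_comm]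
    · rw [if_neg hd]
      by_cases hd' : disj l₁ l₂ = true
      · rw [if_pos hd', map_smul]
        have hi2 : i ∈ l₂ := by
          by_contra hh
          exact hd (disj_iff.mpr fun k hk ↦ by
            rcases List.mem_cons.mp hk with rfl | hk
            · exact hh
            · exact disj_iff.mp hd' k hk)
        rw [e_mul_prodList_of_mem f (mem_mergeIns.mpr (Or.inr hi2)), smul_zero]
      · rw [if_neg hd', map_zero]

/-- `prodList l` is homogeneous of degree `|l|`. -/
theorem prodList_mem_range (l : List (Fin 4)) :
    prodList f l ∈ LinearMap.range (ofDegree ℂ Y l.length) := by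
  induction l with
  | nil => exact ⟨_, rfl⟩
  | cons i l ih =>
    obtain ⟨y, hy⟩ := ih
    rw [prodList_cons, ← hy, e_def, totalCup_lof, List.length_cons]
    exact ⟨cupProduct (Nat.add_comm 1 l.length) (f i) y,
      (ofDegree_cupProduct_index (Nat.add_comm 1 l.length) rfl (f i) y).symm ▸ rfl⟩

/-! ### Bitmasks: the glue to `wsign`, `bor`, `deg4` (checked by `decide`) -/

/-- The set bits of `I ⊂ {0,1,2,3}`, increasing. -/
def bitsList (I : Fin 16) : List (Fin 4) :=
  (List.finRange 4).filter fun i ↦ I.val.testBit i.val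

/-- **Glue** between the list bookkeeping and the bit arithmetic of the model, all `256` pairs by `decide`:
disjointness, the inversion count, the merged list, and the degree. -/
theorem bits_glue : ∀ I J : Fin 16,
    (bitsList I).Nodup ∧ (disj (bitsList I) (bitsList J) = true ↔ I.val &&& J.val = 0) ∧
      (I.val &&& J.val = 0 → invCount (bitsList I) (bitsList J) = inversions I J ∧
        mergeIns (bitsList I) (bitsList J) = bitsList (bor I J)) ∧ (bitsList I).length = deg4 I := by
  decide +kernel

/-- **The ordered basis vectors** `bvec f I = e_{i₁} ⌣ (e_{i₂} ⌣ ⋯)` over the set bits of `I`, increasing. -/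
def bvec (I : Fin 16) : totalCohomology ℂ Y :=
  prodList f (bitsList I)

/-- `bvec f 0 = 1`. -/
theorem bvec_zero : bvec f 0 = ofDegree ℂ Y 0 (singularCohomology.one ℂ Y) := rfl

/-- `bvec f I ∈ H^{|I|}`. -/
theorem bvec_mem_range (I : Fin 16) : bvec f I ∈ LinearMap.range (ofDegree ℂ Y (deg4 I)) := by
  rw [bvec, ← (bits_glue I I).2.2.2]
  exact prodList_mem_range f _

/-- **Structure constants**: `bvec f I ⌣ bvec f J = wsign I J • bvec f (bor I J)`. -/
theorem bvec_mul (I J : Fin 16) :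
    totalCup ℂ Y (bvec f I) (bvec f J) = ((wsign I J : ℤ) : ℂ) • bvec f (bor I J) := by
  obtain ⟨hnd, hdisj, hinv, -⟩ := bits_glue I J
  rw [bvec, bvec, prodList_mul f _ _ hnd, wsign]
  by_cases h0 : I.val &&& J.val = 0
  · obtain ⟨hi, hm⟩ := hinv h0
    rw [if_pos (hdisj.mpr h0), if_neg (by simpa using h0), hi, hm, bvec]
    norm_cast
  · rw [if_neg (fun h ↦ h0 (hdisj.mp h)), if_pos h0, Int.cast_zero, zero_smul]

/-- The singletons: `bvec f (2^i) = e_i`. -/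
theorem bvec_single : bvec f 1 = e f 0 ∧ bvec f 2 = e f 1 ∧ bvec f 4 = e f 2 ∧ bvec f 8 = e f 3 := by
  refine ⟨?_, ?_, ?_, ?_⟩
  · show prodList f (bitsList 1) = _
    rw [show bitsList 1 = [0] from by decide, prodList_cons, prodList_nil, totalCup_one]
  · show prodList f (bitsList 2) = _
    rw [show bitsList 2 = [1] from by decide, prodList_cons, prodList_nil, totalCup_one]
  · show prodList f (bitsList 4) = _
    rw [show bitsList 4 = [2] from by decide, prodList_cons, prodList_nil, totalCup_one]
  · show prodList f (bitsList 8) = _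
    rw [show bitsList 8 = [3] from by decide, prodList_cons, prodList_nil, totalCup_one]

/-- The two symplectic pairs: `bvec f 3 = e₀ ⌣ e₁`, `bvec f 12 = e₂ ⌣ e₃`. -/
theorem bvec_pairs : bvec f 3 = totalCup ℂ Y (e f 0) (e f 1) ∧ bvec f 12 = totalCup ℂ Y (e f 2) (e f 3) := by
  refine ⟨?_, ?_⟩
  · show prodList f (bitsList 3) = _
    rw [show bitsList 3 = [0, 1] from by decide, prodList_cons, prodList_cons, prodList_nil, totalCup_one]
  · show prodList f (bitsList 12) = _
    rw [show bitsList 12 = [2, 3] from by decide, prodList_cons, prodList_cons, prodList_nil, totalCup_one]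

end Model

end Summit.Ventures.HodgeKum4.L1Hilb

end
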